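import Summits.RiemannHypothesis.RiemannHypothesis.Theorems.SignConePointwiseCertEightFifthsData
import Summits.RiemannHypothesis.RiemannHypothesis.Theorems.SignConeCondRungSOSFiftyFiveData

/-!
# Route SignCone: pointwise certificate `pwCert85` (b = 8/5) — SOS tail bound in kernel chunks (B)

Support for the unconditional rung `a ≤ 8/5` (items stmt-RiemannHypothesis-16302 / 16301). The tail clause of the corrected
checker needs `sosBound` of the Dirichlet-SOS certificate `pwCert85sos` (basis `1..60`, rank `50`): too large for one kernel
evaluation, so it is bounded row-chunk by row-chunk (`SOSData.sosBound_eq_sumR`, `sumR_add'`, `decide +kernel`), and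
`pwCert85_tailH` is then DERIVED (file `…EightFifthsTail`).
-/

noncomputable section

-- `Summit.RiemannHypothesis.RiemannHypothesis.…` repeats a namespace component by design (D-0017 layout).
set_option linter.dupNamespace false

open Literature.Analysis.ValidatedNumerics.Numerics Literature.NumberTheory.LFunctions

namespace Summit.RiemannHypothesis.RiemannHypothesis.Theorems.SignCone

set_option maxHeartbeats 0 in
/-- Row chunk `p' ∈ [13, 18)` of `pwCert85sos.sosBound`. [folklore] -/
theorem pwCert85_sosChunk4 :
    (sumR 5 fun i => pwCert85sos.sosInner pwCert85.nodeList pwCert85.a (13 + i)) ≤ (147/10000000) := by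
  decide +kernel

set_option maxHeartbeats 0 in
/-- Row chunk `p' ∈ [18, 23)` of `pwCert85sos.sosBound`. [folklore] -/
theorem pwCert85_sosChunk5 :
    (sumR 5 fun i => pwCert85sos.sosInner pwCert85.nodeList pwCert85.a (18 + i)) ≤ (171/10000000) := by
  decide +kernel

set_option maxHeartbeats 0 in
/-- Row chunk `p' ∈ [23, 29)` of `pwCert85sos.sosBound`. [folklore] -/
theorem pwCert85_sosChunk6 :
    (sumR 6 fun i => pwCert85sos.sosInner pwCert85.nodeList pwCert85.a (23 + i)) ≤ (43/2500000) := by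
  decide +kernel

set_option maxHeartbeats 0 in
/-- Row chunk `p' ∈ [29, 38)` of `pwCert85sos.sosBound`. [folklore] -/
theorem pwCert85_sosChunk7 :
    (sumR 9 fun i => pwCert85sos.sosInner pwCert85.nodeList pwCert85.a (29 + i)) ≤ (57/5000000) := by
  decide +kernel

end Summit.RiemannHypothesis.RiemannHypothesis.Theorems.SignCone

end
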